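import Summits.Ventures.PercRepro.S2ThirteenSixCfOfSpread
import Summits.Ventures.PercRepro.S2TwelveSixK1
import Summits.Ventures.PercRepro.S2ElevenSixK2
import Summits.Ventures.PercRepro.S2ColoopSharp

/-!
# PercRepro — S2: THE CELL `(13, 6)` MODULO TWO SETS OF SPREAD ROWS (p7, gen 15; sub-claim S2; the first cell of the row `p = 13`)

The double coloop split of the cell `(13, 6)` (`RLS M 13 5` on every `e`-free core of rank `13` on `19` points): two coloops give
the twice-scaled cell `(11, 6)` at `K₂ = 12107` (**`c025_eleven_six_k2`**, unconditional — its spread case closes on every row),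
one coloop the scaled cell `(12, 6)` at `K₁ = 10219` (**`c025_twelve_six_cfk1_of_rows`** — its spread rows `t = 6, 7, 8` the
hypothesis `hk1`), no coloop the coloop-free cell (**`c025_thirteen_six_cf_of_spread`** with the spread rows `t ≥ 9` of
`c025_thirteen_six_cf_spread_ge_nine` and the rows `t ≤ 8` the hypothesis `hcf`). **`c025_core_five_thirteen_six_of_rows`**: the
cell `(13, 6)` modulo the spread rows `t ≤ 8` of `(13, 6)` and `t = 6, 7, 8` of `(12, 6)` — everything else of the cell is in the
kernel. NO cell and NO window move is claimed: the window of record is `8 ≤ p ≤ 14` (ADDENDUM 99). Axioms: standard.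
-/

open scoped Matroid

namespace PercRepro

namespace ThmN

open Set

variable {α : Type}

/-- **The cell `(13, 6)` modulo the spread rows `t ≤ 8` of `(13, 6)` and `t = 6, 7, 8` of the scaled `(12, 6)`.** -/
theorem c025_core_five_thirteen_six_of_rows
    (hcf : ∀ (M : Matroid α) [M.Finite], M.eRank = ((13 : ℕ) : ℕ∞) → M.E.ncard = 13 + 6 →
      (∀ e ∈ M.E, ∃ A ⊆ M.E \ {e}, e ∉ M.closure A ∧ e ∉ M.closure ((M.E \ {e}) \ A)) → (∀ e, ¬ M.IsColoop e) →
      ¬ (∃ W ⊆ M.E, W.ncard ≤ 9 ∧ W.encard = M.eRk W + 4) →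
      {C : Set α | M.IsCircuit C ∧ C.ncard = 3}.ncard ≤ 8 → RLS M 13 5)
    (hk1 : ∀ (M : Matroid α) [M.Finite], M.eRank = ((12 : ℕ) : ℕ∞) → M.E.ncard = 12 + 6 →
      (∀ e ∈ M.E, ∃ A ⊆ M.E \ {e}, e ∉ M.closure A ∧ e ∉ M.closure ((M.E \ {e}) \ A)) → (∀ e, ¬ M.IsColoop e) →
      ¬ (∃ W ⊆ M.E, W.ncard ≤ 9 ∧ W.encard = M.eRk W + 4) →
      6 ≤ {C : Set α | M.IsCircuit C ∧ C.ncard = 3}.ncard → {C : Set α | M.IsCircuit C ∧ C.ncard = 3}.ncard ≤ 8 →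
      ((phiK 13 5 - 2) / 2) * (Matroid.topCount M 12 5 : ℚ) ≤ (Matroid.midCount M 12 5 : ℚ))
    (M : Matroid α) [M.Finite]
    (hR : M.eRank = ((13 : ℕ) : ℕ∞)) (hn : M.E.ncard = 13 + 6)
    (hfree : ∀ e ∈ M.E, ∃ A ⊆ M.E \ {e}, e ∉ M.closure A ∧ e ∉ M.closure ((M.E \ {e}) \ A)) : RLS M 13 5 := by
  classical
  by_cases hK : ∃ e, M.IsColoop e
  · obtain ⟨e, he⟩ := hK
    obtain ⟨hn', hR', hfree', -⟩ := delete_core_data M he (p := 12) (d := 6) (by rw [hR]) hn hfree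
    rw [RLS_iff]
    by_cases hK' : ∃ f, (M ＼ {e}).IsColoop f
    · obtain ⟨f, hf⟩ := hK'
      obtain ⟨hn'', hR'', hfree'', -⟩ := delete_core_data (M ＼ {e}) hf (p := 11) (d := 6) (by rw [hR']) hn' hfree'
      have key := c025_eleven_six_k2 ((M ＼ {e}) ＼ {f}) hR'' hn'' hfree''
      exact weighted_of_isColoop_scaled_sharp_iter M he hf (by norm_num : 4 + 1 < 11) (by rw [hR]) (phiK 13 5) key
    · push Not at hK'
      have key := c025_twelve_six_cfk1_of_rows (M ＼ {e}) hR' hn' hfree' hK' (hk1 (M ＼ {e}) hR' hn' hfree' hK')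
      exact weighted_of_isColoop_scaled_sharp M he (by norm_num : 4 + 1 < 12) (by rw [hR]) (phiK 13 5) key
  · push Not at hK
    refine c025_thirteen_six_cf_of_spread M hR hn hfree hK (fun h4 => ?_)
    by_cases ht9 : 9 ≤ {C : Set α | M.IsCircuit C ∧ C.ncard = 3}.ncard
    · exact c025_thirteen_six_cf_spread_ge_nine M hR hn hfree hK h4 ht9
    · exact hcf M hR hn hfree hK h4 (by omega)

end ThmN

end PercRepro
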